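import Summits.BirchSwinnertonDyer.BirchSwinnertonDyer.Theorems.BiquadraticEisensteinDescentManinDatumSupercuspidalCMInertFormalChord
import Literature.AlgebraicGeometry.Resolution.EtaleChartNormal
import Mathlib.RingTheory.Polynomial.ScaleRoots
import HarnessLib

set_option linter.dupNamespace false -- `Summit.BirchSwinnertonDyer.BirchSwinnertonDyer.Theorems.…` (summit = sub, D-0017)
set_option autoImplicit false

/-!
# Crux `ManinDatumSupercuspidalCMInert` (stmt-BirchSwinnertonDyer-20111, BED r605), stub `stub_S7` — CURRENCY lemmas for the torsion core:
# `p ∤ s` multipliers from valuations, and the algebraic integrality of `7ᵃ N/(X(w) − X(t))` for a prime-to-`7` torsion point `w`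
# and a `7`-division point `t` of `y² = x³ − x` (width seat `bsd-wall-cm-bed-w2` g10; theorems only; `--supports 20111`, helper)

Route `BiquadraticEisensteinDescent` (cell `pub/bsd-wall`). Service file for the S7 chain `stub_S7 ⟸ T₇ ⟸ Core₇` (tree:
`…CMInertStubS7OfTorsionIntegral`, `…TorsionCoreBezoutFree`) and the resolvent lane of width seat bsd-wall-cm-bed-w4 g10
(`…TameResolvent`, `…SevenDivisionEisenstein`, `…FormalChord`), which produce VALUATION bounds «`v(z) ≤ …` for every valuation `v` of `ℂ`
with `v 7 < 1`», while Core₇ is stated in the currency «`∃ s, 7 ∤ s, s·z ∈ ℤ̄`». This file supplies the conversion: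

* §1 `exists_not_dvd_isIntegral_div` — for a prime `p`, an algebraic integer `a` and `u ∈ ℤ` with `p ∤ u`: some `s ∈ ℕ` with `p ∤ s` makes
  `s/(u + p·a)` an algebraic integer (bed-w1 g7's `…QuarticTorsionCoordinates.exists_not_three_dvd_isIntegral_div` with `3 ↦ p`).
* §2 ★ `isIntegral_of_forall_valuation` — **valuations to integrality**: if `pᵃ·z ∈ ℤ̄` and `v(z) ≤ 1` for EVERY valuation `v` of `ℂ` with
  `v p < 1`, then `z ∈ ℤ̄` (`z` lies in every valuation subring of `ℂ`: those with `v p < 1` by hypothesis, the others contain `1/p`;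
  Zariski–Samuel, tree `Resolution.isIntegral_of_forall_valuationSubring`). Hence `exists_not_dvd_mul_isIntegral_of_forall_valuation`:
  `pᵃ·N·z ∈ ℤ̄`, `p ∤ N`, `v(z) ≤ 1` at all `v ∣ p` ⇒ `N·z ∈ ℤ̄`.
* §3 `mul_notMem_of_coprime` — `w ∉ Λ`, `M′w ∈ Λ`, `(M′, 7) = 1` ⇒ `7w ∉ Λ`; `aeval_ΨSq_seven_ne_zero` — then `ΨSq₇(X(w)) ≠ 0`
  (`X = ℘/ϖ₀²`; roots of `ΨSq₇` are the `7`-division values, tree `PeriodPair.eval_ΨSq_weierstrassP_eq_zero_iff`).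
* §4 ★ `exists_isIntegral_pow_mul_div_sub` — for such `w` and a `7`-division point `t`: `∃ a N, 7 ∤ N ∧ 7ᵃ·N/(X(w) − X(t)) ∈ ℤ̄`. Proof:
  `ΨSq₇ = ψ₇²`, `ψ₇ = 7G − 1` (bed-w4 g10 `preΨ'_seven_lemniscate`) so `M′⁹⁶ΨSq₇(X(w)) = M′⁹⁶ + 7·(…)` and §1 gives `s₁/(M′⁹⁶ΨSq₇(X(w))) ∈ ℤ̄`;
  and `c^d·ΨSq₇(X(w)) = c^d·(ΨSq₇(X(w)) − ΨSq₇(X(t))) = c·(X(w) − X(t))·Q` with `Q ∈ ℤ̄`, `c = 49M′²` (division `a − b ∣ P(a) − P(b)` in the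
  ring of algebraic integers for the scaled polynomial `(ΨSq₇).scaleRoots c`, whose arguments `cX(w)`, `cX(t)` are integral by
  `torsion_coord_isIntegral`).

HONEST FRAMING: bookkeeping; nothing here proves Core₇/T₇, the stub, the crux, Manin's conjecture or BSD. No definition, no named fact,
no `sorry`; axioms standard.
-/

noncomputable section

open scoped Classical
open Complex PeriodPair Polynomial
open Literature.NumberTheory.EllipticCurves Literature.NumberTheory.EllipticCurves.GaussianLattice

namespace Summit.BirchSwinnertonDyer.BirchSwinnertonDyer.Theorems.BiquadraticEisensteinDescentManinDatumSupercuspidalCMInertSevenDivisionCurrency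

open Summit.BirchSwinnertonDyer.BirchSwinnertonDyer.Theorems.BiquadraticEisensteinDescentManinDatumSupercuspidalCMInertFormalChord
  (val_le_one_of_isIntegral)
open Summit.BirchSwinnertonDyer.BirchSwinnertonDyer.Theorems.BiquadraticEisensteinDescentManinDatumSupercuspidalCMInertSevenDivisionEisenstein
  (preΨ'_seven_lemniscate ΨSq_seven_lemniscate)
open Summit.BirchSwinnertonDyer.BirchSwinnertonDyer.Theorems.InertBadSignedBranchesInertBadAtThreeQuarticTorsionCoordinates
  (torsion_coord_isIntegral)

/-! ## §1 The currency lemma at a prime `p` -/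

/-- **Currency lemma at a prime `p`.** For an algebraic integer `a ∈ ℂ` and `u ∈ ℤ` with `p ∤ u` there is `s ∈ ℕ` with `p ∤ s` such that
`s / (u + p·a)` is an algebraic integer (`g(Y) = p^d f((Y − u)/p)`, `f = minpoly_ℤ a`, has root `δ = u + pa` and `g(0) ≡ (−u)^d (mod p)`;
`s = |g(0)|`, `s/δ = ∓ g.divX(δ)`). Verbatim bed-w1 g7's `exists_not_three_dvd_isIntegral_div` with `3 ↦ p`. [folklore] -/
theorem exists_not_dvd_isIntegral_div {p : ℕ} (hp : p.Prime) {a : ℂ} (ha : IsIntegral ℤ a) {u : ℤ} (hu : ¬ (p : ℤ) ∣ u) :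
    ∃ s : ℕ, ¬ p ∣ s ∧ IsIntegral ℤ ((s : ℂ) / ((u : ℂ) + p * a)) := by
  have hpZ : Prime (p : ℤ) := Nat.prime_iff_prime_int.mp hp
  set δ : ℂ := (u : ℂ) + p * a with hδdef
  set f : ℤ[X] := minpoly ℤ a with hf
  have hfm : f.Monic := minpoly.monic ha
  set p₁ : ℤ[X] := f.scaleRoots p with hp₁
  have hp₁m : p₁.Monic := (monic_scaleRoots_iff (p : ℤ)).mpr hfm
  have hp₁root : aeval ((p : ℂ) * a) p₁ = 0 := by
    have h := scaleRoots_aeval_eq_zero (A := ℂ) (r := (p : ℤ)) (minpoly.aeval ℤ a)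
    simpa using h
  set g : ℤ[X] := p₁.comp (X - C (u : ℤ)) with hg
  have hgroot : aeval δ g = 0 := by
    rw [hg, aeval_comp]
    have hlin : aeval δ (X - C u : ℤ[X]) = (p : ℂ) * a := by
      simp [hδdef]
    rw [hlin]
    exact hp₁root
  have hg0 : g.coeff 0 = p₁.eval (-u) := by
    rw [coeff_zero_eq_eval_zero, hg, eval_comp]
    simp
  set d := f.natDegree with hd
  have hdeg : p₁.natDegree = d := natDegree_scaleRoots f (p : ℤ)
  have heval : p₁.eval (-u) = (∑ i ∈ Finset.range d, f.coeff i * (p : ℤ) ^ (d - i) * (-u) ^ i) + (-u) ^ d := by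
    rw [eval_eq_sum_range, hdeg, Finset.sum_range_succ]
    congr 1
    · refine Finset.sum_congr rfl fun i _ ↦ ?_
      rw [hp₁, coeff_scaleRoots]
    · rw [hp₁, coeff_scaleRoots, ← hd, Nat.sub_self, pow_zero, mul_one]
      rw [show f.coeff d = 1 from hfm.coeff_natDegree, one_mul]
  have hpdvd : (p : ℤ) ∣ ∑ i ∈ Finset.range d, f.coeff i * (p : ℤ) ^ (d - i) * (-u) ^ i := by
    refine Finset.dvd_sum fun i hi ↦ ?_
    have hi' : d - i ≠ 0 := Nat.sub_ne_zero_of_lt (Finset.mem_range.mp hi)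
    exact dvd_mul_of_dvd_left (dvd_mul_of_dvd_right (dvd_pow_self (p : ℤ) hi') _) _
  have hg0_not : ¬ (p : ℤ) ∣ g.coeff 0 := by
    rw [hg0, heval]
    intro h
    have h' : (p : ℤ) ∣ (-u) ^ d := by simpa using dvd_sub h hpdvd
    exact hu ((dvd_neg).mp (hpZ.dvd_of_dvd_pow h'))
  have hδint : IsIntegral ℤ δ := by
    have h1 : IsIntegral ℤ ((u : ℂ)) := by
      simpa using isIntegral_algebraMap (R := ℤ) (A := ℂ) (x := u)
    have h3 : IsIntegral ℤ (((p : ℤ) : ℂ)) := by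
      simpa using isIntegral_algebraMap (R := ℤ) (A := ℂ) (x := (p : ℤ))
    have h2 : IsIntegral ℤ ((p : ℂ) * a) := by simpa using h3.mul ha
    exact h1.add h2
  have hdivX : IsIntegral ℤ (aeval δ g.divX) := by
    have hδmem : δ ∈ integralClosure ℤ ℂ := hδint
    have hmem : aeval δ g.divX ∈ integralClosure ℤ ℂ :=
      Algebra.adjoin_le (Set.singleton_subset_iff.mpr hδmem) (aeval_mem_adjoin_singleton ℤ δ)
    exact hmem
  have hkey : IsIntegral ℤ (((g.coeff 0 : ℤ) : ℂ) / δ) := by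
    by_cases hδ0 : δ = 0
    · rw [hδ0, div_zero]; exact isIntegral_zero
    · have hsplit : aeval δ g = δ * aeval δ g.divX + (g.coeff 0 : ℂ) := by
        conv_lhs => rw [← X_mul_divX_add g]
        simp [map_add, map_mul, aeval_X]
      rw [hgroot] at hsplit
      have : ((g.coeff 0 : ℤ) : ℂ) / δ = -aeval δ g.divX := by
        rw [div_eq_iff hδ0]; linear_combination -hsplit
      rw [this]
      exact hdivX.neg
  refine ⟨(g.coeff 0).natAbs, fun h ↦ hg0_not (Int.ofNat_dvd_left.mpr h), ?_⟩
  rcases Int.natAbs_eq (g.coeff 0) with h | h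
  · have hz : (((g.coeff 0).natAbs : ℕ) : ℤ) = g.coeff 0 := by omega
    have : (((g.coeff 0).natAbs : ℕ) : ℂ) = ((g.coeff 0 : ℤ) : ℂ) := by
      rw [← Int.cast_natCast, hz]
    rw [this]; exact hkey
  · have hz : (((g.coeff 0).natAbs : ℕ) : ℤ) = -g.coeff 0 := by omega
    have : (((g.coeff 0).natAbs : ℕ) : ℂ) = -((g.coeff 0 : ℤ) : ℂ) := by
      rw [← Int.cast_natCast, hz, Int.cast_neg]
    rw [this, neg_div]; exact hkey.neg

/-! ## §2 From valuation bounds at `p` to integrality -/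

/-- ★ **Valuations to integrality.** Let `p` be a prime, `z ∈ ℂ` with `pᵃ·z` an algebraic integer, and suppose `v(z) ≤ 1` for EVERY
valuation `v` of `ℂ` with `v p < 1`. Then `z` is an algebraic integer: `z` lies in every valuation subring `W` of `ℂ` — if `v_W(p) < 1` by
hypothesis, otherwise `p` is a unit of `W` and `z = (pᵃz)·p⁻ᵃ ∈ W` — and the intersection of all valuation subrings is the integral
closure of `ℤ` (Zariski–Samuel; tree `Resolution.isIntegral_of_forall_valuationSubring`). [cite: ZariskiSamuel1960, Vol. II, Ch. VI §4, Thm. 6] -/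
theorem isIntegral_of_forall_valuation {p : ℕ} (hp : p.Prime) {z : ℂ} {a : ℕ} (hint : IsIntegral ℤ ((p : ℂ) ^ a * z))
    (hval : ∀ (Γ₀ : Type) [LinearOrderedCommGroupWithZero Γ₀] (v : Valuation ℂ Γ₀), v p < 1 → v z ≤ 1) :
    IsIntegral ℤ z := by
  refine Literature.AlgebraicGeometry.Resolution.isIntegral_of_forall_valuationSubring (T := ℤ) (L := ℂ)
    fun W _ ↦ ?_
  have hp0 : (p : ℂ) ≠ 0 := Nat.cast_ne_zero.mpr hp.ne_zero
  by_cases h7 : W.valuation (p : ℂ) < 1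
  · exact (W.valuation_le_one_iff z).mp (hval _ W.valuation h7)
  · -- `p` is a unit of `W`
    have hp1 : W.valuation (p : ℂ) = 1 := by
      have hle : W.valuation (p : ℂ) ≤ 1 := by
        have h := val_le_one_of_isIntegral W.valuation
          (by simpa using isIntegral_algebraMap (R := ℤ) (A := ℂ) (x := (p : ℤ)) : IsIntegral ℤ ((p : ℂ)))
        exact h
      exact le_antisymm hle (not_lt.mp h7)
    have hpa : W.valuation ((p : ℂ) ^ a)⁻¹ = 1 := by
      rw [map_inv₀, map_pow, hp1, one_pow, inv_one]
    have hz : z = ((p : ℂ) ^ a * z) * ((p : ℂ) ^ a)⁻¹ := by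
      field_simp
    rw [← W.valuation_le_one_iff, hz, map_mul, hpa, mul_one]
    exact val_le_one_of_isIntegral W.valuation hint

/-- **The `p ∤ s` currency from valuations.** If `pᵃ·N·z` is an algebraic integer with `p ∤ N` and `v(z) ≤ 1` for every valuation `v` of
`ℂ` with `v p < 1`, then `N·z` is an algebraic integer — so `∃ s, p ∤ s, s·z ∈ ℤ̄`. [cite: ZariskiSamuel1960, Vol. II, Ch. VI §4, Thm. 6] -/
theorem exists_not_dvd_mul_isIntegral_of_forall_valuation {p : ℕ} (hp : p.Prime) {z : ℂ} {a N : ℕ} (hN : ¬ p ∣ N)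
    (hint : IsIntegral ℤ ((p : ℂ) ^ a * ((N : ℂ) * z)))
    (hval : ∀ (Γ₀ : Type) [LinearOrderedCommGroupWithZero Γ₀] (v : Valuation ℂ Γ₀), v p < 1 → v z ≤ 1) :
    ∃ s : ℕ, ¬ p ∣ s ∧ IsIntegral ℤ ((s : ℂ) * z) := by
  refine ⟨N, hN, isIntegral_of_forall_valuation hp hint fun Γ₀ _ v hv ↦ ?_⟩
  rw [map_mul]
  have hNv : v (N : ℂ) ≤ 1 := by
    have h := val_le_one_of_isIntegral v
      (by simpa using isIntegral_algebraMap (R := ℤ) (A := ℂ) (x := (N : ℤ)) : IsIntegral ℤ ((N : ℂ)))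
    exact h
  exact mul_le_one' hNv (hval Γ₀ v hv)

/-! ## §3 Prime-to-`7` torsion is not `7`-division -/

/-- If `w ∉ Λ`, `M′·w ∈ Λ` and `(M′, q) = 1` then `q·w ∉ Λ` (Bézout). [folklore] -/
theorem mul_notMem_of_coprime {w : ℂ} {M' q : ℕ} (hw : w ∉ (ofUpperHalfPlane UpperHalfPlane.I).lattice)
    (hMw : ((M' : ℂ) * w) ∈ (ofUpperHalfPlane UpperHalfPlane.I).lattice) (hcop : Nat.Coprime M' q) :
    (q : ℂ) * w ∉ (ofUpperHalfPlane UpperHalfPlane.I).lattice := by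
  intro hqw
  have hcopZ : IsCoprime (M' : ℤ) (q : ℤ) := Int.isCoprime_iff_gcd_eq_one.mpr (by rw [Int.gcd_natCast_natCast]; exact hcop)
  obtain ⟨a, b, hab⟩ := hcopZ
  apply hw
  have : w = (a : ℂ) * ((M' : ℂ) * w) + (b : ℂ) * ((q : ℂ) * w) := by
    have hab' : (a : ℂ) * (M' : ℂ) + (b : ℂ) * (q : ℂ) = 1 := by exact_mod_cast hab
    linear_combination (-w) * hab'
  rw [this]
  exact add_mem (by simpa [zsmul_eq_mul] using (ofUpperHalfPlane UpperHalfPlane.I).lattice.smul_mem a hMw)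
    (by simpa [zsmul_eq_mul] using (ofUpperHalfPlane UpperHalfPlane.I).lattice.smul_mem b hqw)

/-- The curve of the lattice `ϖ₀Λ` is `y² = x³ − x`; `℘_{ϖ₀Λ}(ϖ₀w) = ℘(w)/ϖ₀²`; so `ΨSqₙ(℘(w)/ϖ₀²) = 0 ⟺ n·w ∈ Λ` for `w ∉ Λ`.
(The dictionary used by `torsion_coord_isIntegral`, recorded as an `iff`.) [cite: SilvermanAEC2009, Exercise 3.7 (d)] -/
theorem aeval_ΨSq_eq_zero_iff {w : ℂ} (hw : w ∉ (ofUpperHalfPlane UpperHalfPlane.I).lattice) (n : ℤ) :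
    aeval (℘[ofUpperHalfPlane UpperHalfPlane.I] w / ((Real.Gamma (1 / 4) ^ 2 / (2 * Real.sqrt (2 * Real.pi)) : ℝ) : ℂ) ^ 2)
        ((⟨0, 0, 0, -1, 0⟩ : WeierstrassCurve ℤ).ΨSq n) = 0 ↔
      (n : ℂ) * w ∈ (ofUpperHalfPlane UpperHalfPlane.I).lattice := by
  set ϖ : ℂ := ((Real.Gamma (1 / 4) ^ 2 / (2 * Real.sqrt (2 * Real.pi)) : ℝ) : ℂ) with hϖ
  have hϖ0 : ϖ ≠ 0 := Complex.ofReal_ne_zero.mpr varpi_pos.ne'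
  set L' : PeriodPair := (ofUpperHalfPlane UpperHalfPlane.I).mulLeft ϖ hϖ0 with hL'
  have hg2 : L'.g₂ = 4 := by
    rw [hL', PeriodPair.g₂_mulLeft, g₂_eq_varpi', ← hϖ]
    field_simp
  have hg3 : L'.g₃ = 0 := by
    rw [hL', PeriodPair.g₃_mulLeft, g₃_ofUpperHalfPlane_I, mul_zero]
  have hW : (⟨0, 0, 0, -1, 0⟩ : WeierstrassCurve ℤ).map (algebraMap ℤ ℂ) = L'.curve :=
    PeriodPair.map_eq_curve (by rw [hg2]; norm_num) (by rw [hg3]; norm_num)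
  have hw' : ϖ * w ∉ L'.lattice := by
    rw [hL', PeriodPair.mul_mem_mulLeft_lattice]; exact hw
  have hPw : ℘[L'] (ϖ * w) = ℘[ofUpperHalfPlane UpperHalfPlane.I] w / ϖ ^ 2 := by
    rw [hL', PeriodPair.weierstrassP_mulLeft, div_eq_inv_mul]
  rw [← hPw, PeriodPair.aeval_ΨSq_of_map_eq_curve hW, L'.eval_ΨSq_weierstrassP_eq_zero_iff hw',
    show (n : ℂ) * (ϖ * w) = ϖ * ((n : ℂ) * w) by ring, hL', PeriodPair.mul_mem_mulLeft_lattice]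

/-- **A prime-to-`7` torsion value is not a `7`-division value**: for `w ∉ Λ`, `M′w ∈ Λ`, `(M′, 7) = 1`: `ΨSq₇(℘(w)/ϖ₀²) ≠ 0`.
[cite: SilvermanAEC2009, Exercise 3.7 (d)] -/
theorem aeval_ΨSq_seven_ne_zero {w : ℂ} {M' : ℕ} (hw : w ∉ (ofUpperHalfPlane UpperHalfPlane.I).lattice)
    (hMw : ((M' : ℂ) * w) ∈ (ofUpperHalfPlane UpperHalfPlane.I).lattice) (hcop : Nat.Coprime M' 7) :
    aeval (℘[ofUpperHalfPlane UpperHalfPlane.I] w / ((Real.Gamma (1 / 4) ^ 2 / (2 * Real.sqrt (2 * Real.pi)) : ℝ) : ℂ) ^ 2)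
        ((⟨0, 0, 0, -1, 0⟩ : WeierstrassCurve ℤ).ΨSq ((7 : ℕ) : ℤ)) ≠ 0 := by
  rw [Ne, aeval_ΨSq_eq_zero_iff hw]
  push_cast
  exact mul_notMem_of_coprime hw hMw hcop

/-! ## §4 `7ᵃ·N/(X(w) − X(t))` is an algebraic integer -/

/-- Monomial bookkeeping: `M⁴⁸·X^(2j) = (M²X)^(2j)·M^(48−4j)` for `4j ≤ 48`. [folklore] -/
theorem pow_mul_pow_eq {M X : ℂ} {j : ℕ} (hj : 4 * j ≤ 48) :
    M ^ 48 * X ^ (2 * j) = (M ^ 2 * X) ^ (2 * j) * M ^ (48 - 4 * j) := by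
  rw [mul_pow, ← pow_mul, show M ^ 48 = M ^ (2 * (2 * j)) * M ^ (48 - 4 * j) by rw [← pow_add]; congr 1; omega]
  ring

/-- `M⁴⁸·X^(2j)` is an algebraic integer when `M²X` is and `M ∈ ℕ`, `j ≤ 12`. [folklore] -/
theorem isIntegral_pow_mul_pow {M : ℕ} {X : ℂ} (hX : IsIntegral ℤ ((M : ℂ) ^ 2 * X)) {j : ℕ} (hj : j ≤ 12) :
    IsIntegral ℤ ((M : ℂ) ^ 48 * X ^ (2 * j)) := by
  have hM : IsIntegral ℤ (M : ℂ) := by simpa using isIntegral_algebraMap (R := ℤ) (A := ℂ) (x := (M : ℤ))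
  rw [pow_mul_pow_eq (by omega)]
  exact (hX.pow _).mul (hM.pow _)

/-- ★ **`7ᵃ·N/(X(w) − X(t)) ∈ ℤ̄` for a prime-to-`7` torsion point `w` and a `7`-division point `t` of `y² = x³ − x`** (`X = ℘/ϖ₀²`): there
are `a, N ∈ ℕ` with `7 ∤ N` and `7ᵃ·N/(X(w) − X(t))` an algebraic integer. [cite: SilvermanAEC2009, Exercise 3.7] -/
theorem exists_isIntegral_pow_mul_div_sub {w t : ℂ} {M' : ℕ} (hw : w ∉ (ofUpperHalfPlane UpperHalfPlane.I).lattice)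
    (hMw : ((M' : ℂ) * w) ∈ (ofUpperHalfPlane UpperHalfPlane.I).lattice) (hcop : Nat.Coprime M' 7)
    (ht : t ∉ (ofUpperHalfPlane UpperHalfPlane.I).lattice) (h7t : (7 : ℂ) * t ∈ (ofUpperHalfPlane UpperHalfPlane.I).lattice) :
    ∃ a N : ℕ, ¬ 7 ∣ N ∧ IsIntegral ℤ ((7 : ℂ) ^ a * (N : ℂ) /
      (℘[ofUpperHalfPlane UpperHalfPlane.I] w / ((Real.Gamma (1 / 4) ^ 2 / (2 * Real.sqrt (2 * Real.pi)) : ℝ) : ℂ) ^ 2 -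
        ℘[ofUpperHalfPlane UpperHalfPlane.I] t / ((Real.Gamma (1 / 4) ^ 2 / (2 * Real.sqrt (2 * Real.pi)) : ℝ) : ℂ) ^ 2)) := by
  have hM0 : M' ≠ 0 := by
    rintro rfl
    exact absurd hcop (by decide)
  -- integrality of the scaled coordinates (before naming them)
  obtain ⟨hXw_int, -⟩ := torsion_coord_isIntegral hw hMw hM0
  obtain ⟨hXt_int', -⟩ := torsion_coord_isIntegral (n := 7) ht (by exact_mod_cast h7t) (by norm_num)
  set ϖ : ℂ := ((Real.Gamma (1 / 4) ^ 2 / (2 * Real.sqrt (2 * Real.pi)) : ℝ) : ℂ) with hϖ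
  set Xw : ℂ := ℘[ofUpperHalfPlane UpperHalfPlane.I] w / ϖ ^ 2 with hXw
  set Xt : ℂ := ℘[ofUpperHalfPlane UpperHalfPlane.I] t / ϖ ^ 2 with hXt
  set P : ℤ[X] := (⟨0, 0, 0, -1, 0⟩ : WeierstrassCurve ℤ).ΨSq ((7 : ℕ) : ℤ) with hP
  have hXt_int : IsIntegral ℤ ((7 : ℂ) ^ 2 * Xt) := by simpa using hXt_int'
  have hMint : IsIntegral ℤ (M' : ℂ) := by simpa using isIntegral_algebraMap (R := ℤ) (A := ℂ) (x := (M' : ℤ))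
  have h7int : IsIntegral ℤ (7 : ℂ) := by simpa using isIntegral_algebraMap (R := ℤ) (A := ℂ) (x := (7 : ℤ))
  -- `ΨSq₇(Xt) = 0`, `ΨSq₇(Xw) ≠ 0`
  have hPt : aeval Xt P = 0 := by
    rw [hP, hXt, aeval_ΨSq_eq_zero_iff ht]; push_cast; exact h7t
  have hPw : aeval Xw P ≠ 0 := by
    rw [hP, hXw]; exact aeval_ΨSq_seven_ne_zero hw hMw hcop
  -- the scaled polynomial and the division `A − B ∣ P̃(A) − P̃(B)` in the ring of algebraic integers
  set c : ℕ := 7 ^ 2 * M' ^ 2 with hc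
  have hcA : IsIntegral ℤ ((c : ℂ) * Xw) := by
    have h7 : IsIntegral ℤ ((7 : ℂ) ^ 2) := h7int.pow 2
    have : (c : ℂ) * Xw = (7 : ℂ) ^ 2 * ((M' : ℂ) ^ 2 * Xw) := by rw [hc]; push_cast; ring
    rw [this]; exact h7.mul hXw_int
  have hcB : IsIntegral ℤ ((c : ℂ) * Xt) := by
    have hM : IsIntegral ℤ ((M' : ℂ) ^ 2) := hMint.pow 2
    have : (c : ℂ) * Xt = (M' : ℂ) ^ 2 * ((7 : ℂ) ^ 2 * Xt) := by rw [hc]; push_cast; ring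
    rw [this]; exact hM.mul hXt_int
  set R := integralClosure ℤ ℂ with hR
  set A : R := ⟨(c : ℂ) * Xw, hcA⟩ with hA
  set B : R := ⟨(c : ℂ) * Xt, hcB⟩ with hB
  set Ps : ℤ[X] := P.scaleRoots (c : ℤ) with hPs
  obtain ⟨Q, hQ⟩ := sub_dvd_eval_sub A B (Ps.map (algebraMap ℤ R))
  rw [eval_map_algebraMap, eval_map_algebraMap] at hQ
  have hQC : aeval ((c : ℂ) * Xw) Ps - aeval ((c : ℂ) * Xt) Ps = ((c : ℂ) * Xw - (c : ℂ) * Xt) * (Q : ℂ) := by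
    have h := congrArg (fun x : R ↦ (x : ℂ)) hQ
    simp only [Subalgebra.coe_sub, Subalgebra.coe_mul, aeval_subalgebra_coe] at h
    exact h
  -- values of the scaled polynomial
  set d : ℕ := P.natDegree with hd
  have hscale : ∀ x : ℂ, aeval ((c : ℂ) * x) Ps = (c : ℂ) ^ d * aeval x P := by
    intro x
    have h := scaleRoots_eval₂_mul (p := P) (algebraMap ℤ ℂ) x (c : ℤ)
    rw [aeval_def, aeval_def]
    simpa using h
  rw [hscale, hscale, hPt, mul_zero, sub_zero] at hQC
  -- hQC : c^d * ΨSq₇(Xw) = (c Xw − c Xt) * Q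
  -- the explicit value `ΨSq₇(Xw) = (7G − 1)²`
  set G : ℂ := Xw ^ 24 - 44 * Xw ^ 22 - 422 * Xw ^ 20 + 2836 * Xw ^ 18 - 5033 * Xw ^ 16 + 11752 * Xw ^ 14
      - 15988 * Xw ^ 12 + 6024 * Xw ^ 10 + 2239 * Xw ^ 8 - 2108 * Xw ^ 6 + 186 * Xw ^ 4 - 28 * Xw ^ 2 with hG
  have hPval : aeval Xw P = (7 * G - 1) ^ 2 := by
    rw [hP, ΨSq_seven_lemniscate, map_pow, preΨ'_seven_lemniscate]
    simp only [map_sub, map_add, map_mul, map_pow, aeval_X, map_one, map_ofNat]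
    rw [hG]; ring
  -- `M'⁴⁸ G` is an algebraic integer
  have hg : IsIntegral ℤ ((M' : ℂ) ^ 48 * G) := by
    have hz : ∀ z : ℤ, IsIntegral ℤ (z : ℂ) := fun z ↦ by simpa using isIntegral_algebraMap (R := ℤ) (A := ℂ) (x := z)
    have h := fun (j : ℕ) (hj : j ≤ 12) ↦ isIntegral_pow_mul_pow hXw_int hj
    have e : (M' : ℂ) ^ 48 * G = (M' : ℂ) ^ 48 * Xw ^ (2 * 12) - 44 * ((M' : ℂ) ^ 48 * Xw ^ (2 * 11))
        - 422 * ((M' : ℂ) ^ 48 * Xw ^ (2 * 10)) + 2836 * ((M' : ℂ) ^ 48 * Xw ^ (2 * 9))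
        - 5033 * ((M' : ℂ) ^ 48 * Xw ^ (2 * 8)) + 11752 * ((M' : ℂ) ^ 48 * Xw ^ (2 * 7))
        - 15988 * ((M' : ℂ) ^ 48 * Xw ^ (2 * 6)) + 6024 * ((M' : ℂ) ^ 48 * Xw ^ (2 * 5))
        + 2239 * ((M' : ℂ) ^ 48 * Xw ^ (2 * 4)) - 2108 * ((M' : ℂ) ^ 48 * Xw ^ (2 * 3))
        + 186 * ((M' : ℂ) ^ 48 * Xw ^ (2 * 2)) - 28 * ((M' : ℂ) ^ 48 * Xw ^ (2 * 1)) := by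
      rw [hG]; ring
    rw [e]
    have hc : ∀ (n : ℤ) {x : ℂ}, IsIntegral ℤ x → IsIntegral ℤ ((n : ℂ) * x) := fun n x hx ↦ (hz n).mul hx
    have t12 := h 12 le_rfl
    have t11 := hc 44 (h 11 (by norm_num)); have t10 := hc 422 (h 10 (by norm_num))
    have t9 := hc 2836 (h 9 (by norm_num)); have t8 := hc 5033 (h 8 (by norm_num))
    have t7 := hc 11752 (h 7 (by norm_num)); have t6 := hc 15988 (h 6 (by norm_num))
    have t5 := hc 6024 (h 5 (by norm_num)); have t4 := hc 2239 (h 4 (by norm_num))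
    have t3 := hc 2108 (h 3 (by norm_num)); have t2 := hc 186 (h 2 (by norm_num))
    have t1 := hc 28 (h 1 (by norm_num))
    push_cast at t11 t10 t9 t8 t7 t6 t5 t4 t3 t2 t1
    exact ((((((((((t12.sub t11).sub t10).add t9).sub t8).add t7).sub t6).add t5).add t4).sub t3).add t2).sub t1
  -- `δ := M'⁹⁶ ΨSq₇(Xw) = M'⁹⁶ + 7·a₀` with `a₀ = 7 g² − 2 M'⁴⁸ g`, `g = M'⁴⁸ G`
  set g : ℂ := (M' : ℂ) ^ 48 * G with hgdef
  have hδ : (M' : ℂ) ^ 96 + 7 * (7 * g ^ 2 - 2 * (M' : ℂ) ^ 48 * g) = (M' : ℂ) ^ 96 * aeval Xw P := by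
    rw [hPval, hgdef]; ring
  have ha₀ : IsIntegral ℤ (7 * g ^ 2 - 2 * (M' : ℂ) ^ 48 * g) := by
    have h2 : IsIntegral ℤ (2 : ℂ) := by simpa using isIntegral_algebraMap (R := ℤ) (A := ℂ) (x := (2 : ℤ))
    have h2M : IsIntegral ℤ (2 * (M' : ℂ) ^ 48) := h2.mul (hMint.pow 48)
    exact (h7int.mul (hg.pow 2)).sub (h2M.mul hg)
  have hu : ¬ (7 : ℤ) ∣ (M' : ℤ) ^ 96 := by
    intro h
    have h' : (7 : ℤ) ∣ (M' : ℤ) := (Nat.prime_iff_prime_int.mp (by norm_num : Nat.Prime 7)).dvd_of_dvd_pow h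
    have h'' : 7 ∣ M' := by exact_mod_cast h'
    have := Nat.Coprime.eq_one_of_dvd (Nat.Coprime.symm hcop) h''
    omega
  obtain ⟨s₁, hs₁, hs₁int⟩ := exists_not_dvd_isIntegral_div (p := 7) (by norm_num) ha₀ hu
  push_cast at hs₁int
  rw [hδ] at hs₁int
  -- hs₁int : IsIntegral ℤ (s₁ / (M'⁹⁶ ΨSq₇(Xw)))
  -- assemble: 7^(2d) · (M'^(2d) s₁²) / (Xw − Xt) = c · Q · M'⁹⁶ · (s₁/(M'⁹⁶ ΨSq₇ Xw))² · ΨSq₇(Xw)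
  refine ⟨2 * d, M' ^ (2 * d) * s₁ ^ 2, ?_, ?_⟩
  · intro h
    rcases (Nat.Prime.dvd_mul (by norm_num : Nat.Prime 7)).mp h with h | h
    · have h' : 7 ∣ M' := Nat.Prime.dvd_of_dvd_pow (by norm_num) h
      have := Nat.Coprime.eq_one_of_dvd (Nat.Coprime.symm hcop) h'
      omega
    · exact hs₁ (Nat.Prime.dvd_of_dvd_pow (by norm_num) h)
  · have hM' : (M' : ℂ) ≠ 0 := Nat.cast_ne_zero.mpr hM0
    have hc0 : (c : ℂ) ≠ 0 := by rw [hc]; push_cast; exact mul_ne_zero (by norm_num) (pow_ne_zero _ hM')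
    have hsub : Xw - Xt ≠ 0 := by
      intro h0
      have : (c : ℂ) ^ d * aeval Xw P = 0 := by rw [hQC, show (c : ℂ) * Xw - c * Xt = c * (Xw - Xt) by ring, h0]; ring
      exact absurd this (mul_ne_zero (pow_ne_zero _ hc0) hPw)
    have hval : aeval Xw P ≠ 0 := hPw
    have key : (7 : ℂ) ^ (2 * d) * ((M' ^ (2 * d) * s₁ ^ 2 : ℕ) : ℂ) / (Xw - Xt) =
        (c : ℂ) * (Q : ℂ) * ((M' : ℂ) ^ 96 * ((M' : ℂ) ^ 96 * aeval Xw P)) *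
          (((s₁ : ℂ) / ((M' : ℂ) ^ 96 * aeval Xw P)) ^ 2) := by
      have hcd : (c : ℂ) ^ d = (7 : ℂ) ^ (2 * d) * (M' : ℂ) ^ (2 * d) := by
        rw [hc, pow_mul, pow_mul]; push_cast; ring
      rw [div_eq_iff hsub]
      field_simp
      -- use `c^d ΨSq(Xw) = c (Xw − Xt) Q`
      have hQC' : (c : ℂ) ^ d * aeval Xw P = (c : ℂ) * (Xw - Xt) * (Q : ℂ) := by rw [hQC]; ring
      rw [hcd] at hQC'
      push_cast
      linear_combination ((s₁ : ℂ) ^ 2) * hQC'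
    rw [key]
    have hcint : IsIntegral ℤ (c : ℂ) := by simpa using isIntegral_algebraMap (R := ℤ) (A := ℂ) (x := (c : ℤ))
    have hPint : IsIntegral ℤ ((M' : ℂ) ^ 96 * aeval Xw P) := by
      rw [← hδ]
      exact (hMint.pow 96).add (h7int.mul ha₀)
    exact ((hcint.mul Q.2).mul ((hMint.pow 96).mul hPint)).mul (hs₁int.pow 2)

end Summit.BirchSwinnertonDyer.BirchSwinnertonDyer.Theorems.BiquadraticEisensteinDescentManinDatumSupercuspidalCMInertSevenDivisionCurrency

end
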